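import Summits.QuantumFields.BalabanUV.Beta.GAN24.ForcingFacePairFormAssembly
import Summits.QuantumFields.BalabanUV.Beta.GAN24.DeepFaceAntisymSpure
import Summits.QuantumFields.BalabanUV.Beta.GAN24.ForcingTableRootLetters
import Summits.QuantumFields.BalabanUV.Beta.GAN24.CombesThomas

/-!
# `BalabanUV.Beta.GAN24.CombChargeTowerForcingAdapter` — binder row G-an2-4 ∕ (CONV-C), W-slot (α-0), ROW (C) AT LEVELS `≥ 1` (the OWNER's two-index tower, RULING
# R-gan24p1-g40-1; typer's PART VI row T6-STEP): **ROAD-P2's ADAPTER — THE E-FRAME FORCING's BOND-SYMMETRISED FACE READS AT EVERY COARSE PERIOD ARE PAIR FORMS, FOR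
# ROAD-P2's ACTUAL TOWER LETTERS (`hBF (m, i)` of `CombChargeTowerClosure` VERBATIM), FROM leaf-02's Part 50c and Part 51** — the side conditions discharged by
# road-P2's `ForcingTableRootLetters` (locality, `Lc`-block translation laws, parity-odd rows of the three first tables through the units), generic `d`
# (road-P2 chair `b2b-balaban-gan24-p2`, gen 51; journal [GAN24P2-G51-INTENT1])

NOT IN PRINT; OUR BOOKKEEPING ([folklore] instantiation + β-reduction BY NAME: leaf-02 g69's `ForcingFacePairFormAssembly.forcingPairForm_dressedStep` (Parts 44a–50c:
leaf-06 K6c's opening of the face read at every period, the coarse-to-deep push of the weighted legs, the exchange words' pair form from the two deep-face antisymmetries,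
the W word's `LS`-null) and `DeepFaceAntisymSpure.deepFace_unitS_SpureRecAt_weightedFirst ∕ _freeFirst` (leaf-04's `CurrentSymTower` F5 at every deep period `Lc·P`);
road-P2's side conditions from an2's `SpineRooted.locStencil_SpureRecAt ∕ SpureRecAt_translate ∕ vertexFamily_M1At ∕ M1At_translate`, `SpineRecursivePureParity.trK_SpureRecAt`,
`SpineRecursiveParity.trK_M1At`, an1's `MixedJetTablesPlug.hmix_an1 ∕ hmixt_an1` with `BalabanStepW2.locStencilFM_M2Of ∕ M2Of_translate`, the unit transports
`HessKerDressedUnits.locStencil_unitS`, `VHWordsZeroBorder.unitS_translate_block`, leaf-04's `DressedSourceZeroModeLevelZero.locStencilFM_unitM₂` and leaf-02 48 §1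
`FaceWWordLetters.trK_unitS_of_rows ∕ trK_unitM_of_rows`; 0 `def`, 0 cited fact, 0 `def … : Prop`, 0 sorry).  HONEST FRAMING (cell contract, verbatim): «discharging `BetaPertH`
makes Bałaban's UV stability UNCONDITIONAL — a real constructive-QFT result; it is NOT the continuum limit and NOT the Clay problem.»  HONEST DEPENDENCY (verbatim): «continuum YM
on T⁴ ⇐ BetaPertH ∧ nine spine estimates (0/9 proved); BetaPertH ⇐ (D1) ∧ (D4) ∧ CAP+tail; G-an2-4 gates asym, D1 and NE2/3/4.»

WHAT.  `S̃_j := unitS (sfStep Lc j) (smStep d Lc j) (SpureRecAt d Lc ρ_c cE cVH cΛ j)`, `M̃_j := unitM … (M1At d Lc ρ_c cΛ j)`, `M̃₂_j := unitM₂ … (M2Of d Lc (mixFFAt ρ_c Lc) j)`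
(root `ρ_c = toSite r`, `r ∈ box`), `X̃_j := unitK … (coDressKBmAt ρ_c Lc (KInvStep Lc j))`, the E-frame forcing `b̃_j := c•mmRead Lc (K3OfK X̃_j Lc S̃_j M̃_j (W2SymOfK X̃_j Lc S̃_j M̃_j 0 M̃₂_j)) + cB•B`:
* §1 the ROOT LETTERS are `ForcingTableRootLetters`' (every `j`, generic `d`, any `sf sm`; imported BY NAME).
* §2 **`forcingFacePairForm_root (hLc : 1 ≤ Lc) (hr) (cE cVH cΛ c cB) (hBff) (hP : 1 ≤ P) (i)`**: `∃ T antisym², ∀ κ κ' κ₁ κ₂, LS(FF_P(b̃_i)(κκ') + FF_P(b̃_i)(κ'κ))(inl κ₁, inl κ₂) = T-form`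
  — road-P2's `hBF` binder shape at ONE coarse period `P ≥ 1` (one conjunctive mask `[bb_κ][u'_κ'][x_κ₁][z_κ₂]_P`, cell `box P`), generic `d`, ANY `c cB`, ANY `B` with zero
  `inl–inl` block; NO hypothesis left but `1 ≤ Lc`, `r ∈ box`, `hBff`.
* §3 **`forcingFacePairForms_root`** (`d = 3`, `c := cE₂·Lc^{2(d+1)}`, `P 0 = Lc`, `P (m+1) = Lc·P m`): **`∀ m i, hBF m i`** — the hypothesis `hBF` of
  `CombChargeTowerClosure.pairFormLS_member_and_faceReads_of_forcingPairForms` ∕ `…_member_of_forcingPairForms` ∕ `zsymLegSymEven_of_forcingPairForms_crossed` TOKEN FOR TOKEN.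
READING (zero weight until every link is ✓): with leaf-06 g55's `ForcingCellPairFormSucc.forcingCellPairForms` (`hB0` ∀ i at the E pins) the closure's two supplier sockets are
inhabited; road-P2's `hPair` at every level then costs NOTHING beyond the pins, and F9 §3's even-class row costs ONLY the crossed ledger `hX` ∕ `hXu` (leaf-03 ∕ leaf-06 ∕ the
OWNER's (R-a)…(R-W)).  Asserts NO value and NO shape of Bałaban's tables; discharges NOTHING of `hX` ∕ `hXu` ∕ (Q-L) ∕ (H1♮) ∕ (hW, hWall); NEVER «G-an2-4 closed» as (CONV-C);
NOT D1, NOT `BetaPertH`, NOT continuum, NOT Clay.  2026-08-24; no existing file touched.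
-/

noncomputable section

open Finset
open scoped BigOperators
open Literature.MathematicalPhysics.QuantumFieldTheory
open Literature.MathematicalPhysics.QuantumFieldTheory.Balaban1983to89
open Literature.MathematicalPhysics.QuantumFieldTheory.Balaban1983to89.Beta
open ExpKernelCalculus (Site MKer shiftK VertexFamily)
open OneStepResolventKernel (Fib LocStencil)
open OneStepKernelFamily (KInvStep)
open SecondOrderResponse (W2SymOfK LocStencilFM)
open BalabanStepJetsSucc (mmRead)
open BalabanStepW2 (K3OfK M2Of)
open AffineAveraging (box toSite)
open AveragingMixedJetTables (mixFFAt)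
open Summit.QuantumFields.BalabanUV.Beta.AxialDressingRooted (coDressKBmAt)
open Summit.QuantumFields.BalabanUV.Beta.HessKerDressedUnits (unitK unitS)
open Summit.QuantumFields.BalabanUV.Beta.SecondOrderUnits (unitM unitM₂)
open Summit.QuantumFields.BalabanUV.Beta.SpineRooted (SpureRecAt M1At)
open Summit.QuantumFields.BalabanUV.Beta.GAN24.CombesThomas (sfStep smStep)
open Summit.QuantumFields.BalabanUV.Beta.GAN24.BiStencilZeroMode (Tab)
open Summit.QuantumFields.BalabanUV.Beta.GAN24.ForcingTableRootLetters (exists_locStencil_unitS_SpureRecAt unitS_SpureRecAt_translate trK_unitS_SpureRecAt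
  vertexFamily_unitM_M1At unitM_M1At_translate trK_unitM_M1At exists_locStencilFM_unitM₂_M2Of unitM₂_M2Of_translate)
open Summit.QuantumFields.BalabanUV.Beta.GAN24.ForcingFacePairFormAssembly (forcingPairForm_dressedStep)
open Summit.QuantumFields.BalabanUV.Beta.GAN24.DeepFaceAntisymSpure (deepFace_unitS_SpureRecAt_weightedFirst deepFace_unitS_SpureRecAt_freeFirst)

namespace Summit.QuantumFields.BalabanUV.Beta.GAN24.CombChargeTowerForcingAdapter

variable {d : ℕ} {Lc : ℕ} [NeZero Lc] {r : Fin (d + 1) → ℕ}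

/-! ## §2 `hBF` at one coarse period, generic `d` -/

/-- NOT IN PRINT; OUR BOOKKEEPING.  **ROAD-P2's `hBF` AT ONE COARSE PERIOD** (module docstring §2): the leg-and-bond symmetrised `P`-face read of the E-frame forcing
`b̃_i` (inl–inl block) is an antisymmetric-pair form — leaf-02's `forcingPairForm_dressedStep` with every side condition discharged by §1 and the two deep-face
antisymmetries by `deepFace_unitS_SpureRecAt_weightedFirst ∕ _freeFirst` at `N := Lc·P`. -/
theorem forcingFacePairForm_root (hLc : 1 ≤ Lc) (hr : r ∈ box (d + 1) Lc) (cE cVH cΛ c cB : ℝ)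
    {B : Tab d} (hBff : ∀ κ u κ' u' x z (α β : Fin (d + 1)), B κ u κ' u' x z (Sum.inl α) (Sum.inl β) = 0) {P : ℕ} (hP : 1 ≤ P) (i : ℕ) :
    ∃ T : Fin (d + 1) → Fin (d + 1) → Fin (d + 1) → Fin (d + 1) → ℝ,
      (∀ a b c e : Fin (d + 1), T b a c e = -T a b c e) ∧ (∀ a b c e : Fin (d + 1), T a b e c = -T a b c e) ∧
      ∀ κ κ' κ₁ κ₂ : Fin (d + 1),
        (((∑ bb ∈ box (d + 1) (P), ∑' u' : Site (d + 1), ∑' x : Site (d + 1), ∑' z : Site (d + 1),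
          (if toSite bb κ % ((P : ℕ) : ℤ) = ((P : ℕ) : ℤ) - 1 ∧ u' κ' % ((P : ℕ) : ℤ) = ((P : ℕ) : ℤ) - 1 ∧ x κ₁ % ((P : ℕ) : ℤ) = ((P : ℕ) : ℤ) - 1 ∧ z κ₂ % ((P : ℕ) : ℤ) = ((P : ℕ) : ℤ) - 1 then
            ((fun κ u κ' u' => c • mmRead Lc (K3OfK (unitK (sfStep Lc i) (smStep d Lc i) (coDressKBmAt (toSite r) Lc (KInvStep (d := d) Lc i))) Lc (unitS (sfStep Lc i) (smStep d Lc i) (SpureRecAt d Lc (toSite r) cE cVH cΛ i)) (unitM (sfStep Lc i) (smStep d Lc i) (M1At d Lc (toSite r) cΛ i)) (W2SymOfK (unitK (sfStep Lc i) (smStep d Lc i) (coDressKBmAt (toSite r) Lc (KInvStep (d := d) Lc i))) Lc (unitS (sfStep Lc i) (smStep d Lc i) (SpureRecAt d Lc (toSite r) cE cVH cΛ i)) (unitM (sfStep Lc i) (smStep d Lc i) (M1At d Lc (toSite r) cΛ i)) 0 (unitM₂ (sfStep Lc i) (smStep d Lc i) (M2Of d Lc (mixFFAt (toSite r) Lc)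 i))) κ u κ' u') + cB • B κ u κ' u')) κ (toSite bb) κ' u' x z (Sum.inl κ₁) (Sum.inl κ₂) else 0))
        + (∑ bb ∈ box (d + 1) (P), ∑' u' : Site (d + 1), ∑' x : Site (d + 1), ∑' z : Site (d + 1),
          (if toSite bb κ' % ((P : ℕ) : ℤ) = ((P : ℕ) : ℤ) - 1 ∧ u' κ % ((P : ℕ) : ℤ) = ((P : ℕ) : ℤ) - 1 ∧ x κ₁ % ((P : ℕ) : ℤ) = ((P : ℕ) : ℤ) - 1 ∧ z κ₂ % ((P : ℕ) : ℤ) = ((P : ℕ) : ℤ) - 1 then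
            ((fun κ u κ' u' => c • mmRead Lc (K3OfK (unitK (sfStep Lc i) (smStep d Lc i) (coDressKBmAt (toSite r) Lc (KInvStep (d := d) Lc i))) Lc (unitS (sfStep Lc i) (smStep d Lc i) (SpureRecAt d Lc (toSite r) cE cVH cΛ i)) (unitM (sfStep Lc i) (smStep d Lc i) (M1At d Lc (toSite r) cΛ i)) (W2SymOfK (unitK (sfStep Lc i) (smStep d Lc i) (coDressKBmAt (toSite r) Lc (KInvStep (d := d) Lc i))) Lc (unitS (sfStep Lc i) (smStep d Lc i) (SpureRecAt d Lc (toSite r) cE cVH cΛ i)) (unitM (sfStep Lc i) (smStep d Lc i) (M1At d Lc (toSite r) cΛ i)) 0 (unitM₂ (sfStep Lc i) (smStep d Lc i) (M2Of d Lc (mixFFAt (toSite r) Lc) i))) κ u κ' u') + cB • B κ u κ' u')) κ' (toSite bb) κ u' x z (Sum.inl κ₁) (Sum.inl κ₂) else 0)))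
      + ((∑ bb ∈ box (d + 1) (P), ∑' u' : Site (d + 1), ∑' x : Site (d + 1), ∑' z : Site (d + 1),
          (if toSite bb κ' % ((P : ℕ) : ℤ) = ((P : ℕ) : ℤ) - 1 ∧ u' κ % ((P : ℕ) : ℤ) = ((P : ℕ) : ℤ) - 1 ∧ x κ₁ % ((P : ℕ) : ℤ) = ((P : ℕ) : ℤ) - 1 ∧ z κ₂ % ((P : ℕ) : ℤ) = ((P : ℕ) : ℤ) - 1 then
            ((fun κ u κ' u' => c • mmRead Lc (K3OfK (unitK (sfStep Lc i) (smStep d Lc i) (coDressKBmAt (toSite r) Lc (KInvStep (d := d) Lc i))) Lc (unitS (sfStep Lc i) (smStep d Lc i) (SpureRecAt d Lc (toSite r) cE cVH cΛ i)) (unitM (sfStep Lc i) (smStep d Lc i) (M1At d Lc (toSite r) cΛ i)) (W2SymOfK (unitK (sfStep Lc i) (smStep d Lc i) (coDressKBmAt (toSite r) Lc (KInvStep (d := d) Lc i))) Lc (unitS (sfStep Lc i) (smStep d Lc i) (SpureRecAt d Lc (toSite r) cE cVH cΛ i)) (unitM (sfStep Lc i) (smStep d Lc i) (M1At d Lc (toSite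 r) cΛ i)) 0 (unitM₂ (sfStep Lc i) (smStep d Lc i) (M2Of d Lc (mixFFAt (toSite r) Lc) i))) κ u κ' u') + cB • B κ u κ' u')) κ' (toSite bb) κ u' x z (Sum.inl κ₁) (Sum.inl κ₂) else 0))
        + (∑ bb ∈ box (d + 1) (P), ∑' u' : Site (d + 1), ∑' x : Site (d + 1), ∑' z : Site (d + 1),
          (if toSite bb κ % ((P : ℕ) : ℤ) = ((P : ℕ) : ℤ) - 1 ∧ u' κ' % ((P : ℕ) : ℤ) = ((P : ℕ) : ℤ) - 1 ∧ x κ₁ % ((P : ℕ) : ℤ) = ((P : ℕ) : ℤ) - 1 ∧ z κ₂ % ((P : ℕ) : ℤ) = ((P : ℕ) : ℤ) - 1 then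
            ((fun κ u κ' u' => c • mmRead Lc (K3OfK (unitK (sfStep Lc i) (smStep d Lc i) (coDressKBmAt (toSite r) Lc (KInvStep (d := d) Lc i))) Lc (unitS (sfStep Lc i) (smStep d Lc i) (SpureRecAt d Lc (toSite r) cE cVH cΛ i)) (unitM (sfStep Lc i) (smStep d Lc i) (M1At d Lc (toSite r) cΛ i)) (W2SymOfK (unitK (sfStep Lc i) (smStep d Lc i) (coDressKBmAt (toSite r) Lc (KInvStep (d := d) Lc i))) Lc (unitS (sfStep Lc i) (smStep d Lc i) (SpureRecAt d Lc (toSite r) cE cVH cΛ i)) (unitM (sfStep Lc i) (smStep d Lc i) (M1At d Lc (toSite r) cΛ i)) 0 (unitM₂ (sfStep Lc i) (smStep d Lc i) (M2Of d Lc (mixFFAt (toSite r) Lc) i))) κ u κ' u') + cB • B κ u κ' u')) κ (toSite bb) κ' u' x z (Sum.inl κ₁) (Sum.inl κ₂) else 0)))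
      + (((∑ bb ∈ box (d + 1) (P), ∑' u' : Site (d + 1), ∑' x : Site (d + 1), ∑' z : Site (d + 1),
          (if toSite bb κ % ((P : ℕ) : ℤ) = ((P : ℕ) : ℤ) - 1 ∧ u' κ' % ((P : ℕ) : ℤ) = ((P : ℕ) : ℤ) - 1 ∧ x κ₂ % ((P : ℕ) : ℤ) = ((P : ℕ) : ℤ) - 1 ∧ z κ₁ % ((P : ℕ) : ℤ) = ((P : ℕ) : ℤ) - 1 then
            ((fun κ u κ' u' => c • mmRead Lc (K3OfK (unitK (sfStep Lc i) (smStep d Lc i) (coDressKBmAt (toSite r) Lc (KInvStep (d := d) Lc i))) Lc (unitS (sfStep Lc i) (smStep d Lc i) (SpureRecAt d Lc (toSite r) cE cVH cΛ i)) (unitM (sfStep Lc i) (smStep d Lc i) (M1At d Lc (toSite r) cΛ i)) (W2SymOfK (unitK (sfStep Lc i) (smStep d Lc i) (coDressKBmAt (toSite r) Lc (KInvStep (d := d) Lc i))) Lc (unitS (sfStep Lc i) (smStep d Lc i) (SpureRecAt d Lc (toSite r) cE cVH cΛ i)) (unitM (sfStep Lc i) (smStep d Lc i) (M1At d Lc (toSite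 r) cΛ i)) 0 (unitM₂ (sfStep Lc i) (smStep d Lc i) (M2Of d Lc (mixFFAt (toSite r) Lc) i))) κ u κ' u') + cB • B κ u κ' u')) κ (toSite bb) κ' u' x z (Sum.inl κ₂) (Sum.inl κ₁) else 0))
        + (∑ bb ∈ box (d + 1) (P), ∑' u' : Site (d + 1), ∑' x : Site (d + 1), ∑' z : Site (d + 1),
          (if toSite bb κ' % ((P : ℕ) : ℤ) = ((P : ℕ) : ℤ) - 1 ∧ u' κ % ((P : ℕ) : ℤ) = ((P : ℕ) : ℤ) - 1 ∧ x κ₂ % ((P : ℕ) : ℤ) = ((P : ℕ) : ℤ) - 1 ∧ z κ₁ % ((P : ℕ) : ℤ) = ((P : ℕ) : ℤ) - 1 then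
            ((fun κ u κ' u' => c • mmRead Lc (K3OfK (unitK (sfStep Lc i) (smStep d Lc i) (coDressKBmAt (toSite r) Lc (KInvStep (d := d) Lc i))) Lc (unitS (sfStep Lc i) (smStep d Lc i) (SpureRecAt d Lc (toSite r) cE cVH cΛ i)) (unitM (sfStep Lc i) (smStep d Lc i) (M1At d Lc (toSite r) cΛ i)) (W2SymOfK (unitK (sfStep Lc i) (smStep d Lc i) (coDressKBmAt (toSite r) Lc (KInvStep (d := d) Lc i))) Lc (unitS (sfStep Lc i) (smStep d Lc i) (SpureRecAt d Lc (toSite r) cE cVH cΛ i)) (unitM (sfStep Lc i) (smStep d Lc i) (M1At d Lc (toSite r) cΛ i)) 0 (unitM₂ (sfStep Lc i) (smStep d Lc i) (M2Of d Lc (mixFFAt (toSite r) Lc) i))) κ u κ' u') + cB • B κ u κ' u')) κ' (toSite bb) κ u' x z (Sum.inl κ₂) (Sum.inl κ₁) else 0)))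
      + ((∑ bb ∈ box (d + 1) (P), ∑' u' : Site (d + 1), ∑' x : Site (d + 1), ∑' z : Site (d + 1),
          (if toSite bb κ' % ((P : ℕ) : ℤ) = ((P : ℕ) : ℤ) - 1 ∧ u' κ % ((P : ℕ) : ℤ) = ((P : ℕ) : ℤ) - 1 ∧ x κ₂ % ((P : ℕ) : ℤ) = ((P : ℕ) : ℤ) - 1 ∧ z κ₁ % ((P : ℕ) : ℤ) = ((P : ℕ) : ℤ) - 1 then
            ((fun κ u κ' u' => c • mmRead Lc (K3OfK (unitK (sfStep Lc i) (smStep d Lc i) (coDressKBmAt (toSite r) Lc (KInvStep (d := d) Lc i))) Lc (unitS (sfStep Lc i) (smStep d Lc i) (SpureRecAt d Lc (toSite r) cE cVH cΛ i)) (unitM (sfStep Lc i) (smStep d Lc i) (M1At d Lc (toSite r) cΛ i)) (W2SymOfK (unitK (sfStep Lc i) (smStep d Lc i) (coDressKBmAt (toSite r) Lc (KInvStep (d := d) Lc i))) Lc (unitS (sfStep Lc i) (smStep d Lc i) (SpureRecAt d Lc (toSite r) cE cVH cΛ i)) (unitM (sfStep Lc i) (smStep d Lc i) (M1At d Lc (toSite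 r) cΛ i)) 0 (unitM₂ (sfStep Lc i) (smStep d Lc i) (M2Of d Lc (mixFFAt (toSite r) Lc) i))) κ u κ' u') + cB • B κ u κ' u')) κ' (toSite bb) κ u' x z (Sum.inl κ₂) (Sum.inl κ₁) else 0))
        + (∑ bb ∈ box (d + 1) (P), ∑' u' : Site (d + 1), ∑' x : Site (d + 1), ∑' z : Site (d + 1),
          (if toSite bb κ % ((P : ℕ) : ℤ) = ((P : ℕ) : ℤ) - 1 ∧ u' κ' % ((P : ℕ) : ℤ) = ((P : ℕ) : ℤ) - 1 ∧ x κ₂ % ((P : ℕ) : ℤ) = ((P : ℕ) : ℤ) - 1 ∧ z κ₁ % ((P : ℕ) : ℤ) = ((P : ℕ) : ℤ) - 1 then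
            ((fun κ u κ' u' => c • mmRead Lc (K3OfK (unitK (sfStep Lc i) (smStep d Lc i) (coDressKBmAt (toSite r) Lc (KInvStep (d := d) Lc i))) Lc (unitS (sfStep Lc i) (smStep d Lc i) (SpureRecAt d Lc (toSite r) cE cVH cΛ i)) (unitM (sfStep Lc i) (smStep d Lc i) (M1At d Lc (toSite r) cΛ i)) (W2SymOfK (unitK (sfStep Lc i) (smStep d Lc i) (coDressKBmAt (toSite r) Lc (KInvStep (d := d) Lc i))) Lc (unitS (sfStep Lc i) (smStep d Lc i) (SpureRecAt d Lc (toSite r) cE cVH cΛ i)) (unitM (sfStep Lc i) (smStep d Lc i) (M1At d Lc (toSite r) cΛ i)) 0 (unitM₂ (sfStep Lc i) (smStep d Lc i) (M2Of d Lc (mixFFAt (toSite r) Lc) i))) κ u κ' u') + cB • B κ u κ' u')) κ (toSite bb) κ' u' x z (Sum.inl κ₂) (Sum.inl κ₁) else 0)))))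
          = T κ κ₁ κ' κ₂ + T κ' κ₁ κ κ₂ + (T κ κ₂ κ' κ₁ + T κ' κ₂ κ κ₁) := by
  obtain ⟨Cs, δs, hδs, hS⟩ := exists_locStencil_unitS_SpureRecAt hLc hr (sfStep Lc i) (smStep d Lc i) cE cVH cΛ i
  obtain ⟨C₂, δ₂, hδ₂, hM₂⟩ := exists_locStencilFM_unitM₂_M2Of hLc hr (sfStep Lc i) (smStep d Lc i) i
  have hN : 1 ≤ Lc * P := Nat.mul_pos hLc hP
  obtain ⟨T, hT1, hT2, hT⟩ := forcingPairForm_dressedStep (d := d) hLc hr hP (sfStep Lc i) (smStep d Lc i) i hS hδs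
    (vertexFamily_unitM_M1At hLc hr (sfStep Lc i) (smStep d Lc i) cΛ i) one_pos
    (fun κ u t => unitS_SpureRecAt_translate (r := r) hLc (sfStep Lc i) (smStep d Lc i) cE cVH cΛ i κ u t)
    (fun ρ' w t => unitM_M1At_translate (Lc := Lc) (r := r) (sfStep Lc i) (smStep d Lc i) cΛ i ρ' w t)
    (fun κ u => trK_unitS_SpureRecAt hLc hr (sfStep Lc i) (smStep d Lc i) cE cVH cΛ i κ u)
    (fun ρ' w => trK_unitM_M1At (Lc := Lc) (r := r) (sfStep Lc i) (smStep d Lc i) cΛ i ρ' w)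
    hM₂ hδ₂ (fun κ u ρ' w t => unitM₂_M2Of_translate (Lc := Lc) (r := r) (sfStep Lc i) (smStep d Lc i) i κ u ρ' w t) hBff c cB
    (fun ν β p a' => deepFace_unitS_SpureRecAt_weightedFirst hr (sfStep Lc i) (smStep d Lc i) cE cVH cΛ i hN (dvd_mul_right Lc P) ν β p a')
    (fun μ ν s f => deepFace_unitS_SpureRecAt_freeFirst hr (sfStep Lc i) (smStep d Lc i) cE cVH cΛ i hN (dvd_mul_right Lc P) μ ν s f)
  exact ⟨T, hT1, hT2, fun κ κ' κ₁ κ₂ => by simpa only using hT κ κ' κ₁ κ₂⟩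

end Summit.QuantumFields.BalabanUV.Beta.GAN24.CombChargeTowerForcingAdapter

/-! ## §3 `∀ m i, hBF m i` — the hypothesis of `CombChargeTowerClosure` token for token (`d = 3`) -/

namespace Summit.QuantumFields.BalabanUV.Beta.GAN24.CombChargeTowerForcingAdapter

variable {Lc : ℕ} [NeZero Lc] {r : Fin (3 + 1) → ℕ}

/-- NOT IN PRINT; OUR BOOKKEEPING.  **`hBF` OF `CombChargeTowerClosure` AT EVERY (period index, level)** (module docstring §3). -/
theorem forcingFacePairForms_root (hLc : 1 ≤ Lc) (hr : r ∈ box (3 + 1) Lc) (cE cVH cΛ cE₂ cB : ℝ)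
    {vh₂S : Tab 3} (hBff : ∀ κ u κ' u' x z (α β : Fin (3 + 1)), vh₂S κ u κ' u' x z (Sum.inl α) (Sum.inl β) = 0)
    (P : ℕ → ℕ) (hP0 : P 0 = Lc) (hPs : ∀ m, P (m + 1) = Lc * P m) :
    ∀ (m i : ℕ), ∃ T : Fin (3 + 1) → Fin (3 + 1) → Fin (3 + 1) → Fin (3 + 1) → ℝ,
      (∀ a b c e : Fin (3 + 1), T b a c e = -T a b c e) ∧ (∀ a b c e : Fin (3 + 1), T a b e c = -T a b c e) ∧
      ∀ κ κ' κ₁ κ₂ : Fin (3 + 1),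
        (((∑ bb ∈ box (3 + 1) (P m), ∑' u' : Site (3 + 1), ∑' x : Site (3 + 1), ∑' z : Site (3 + 1),
          (if toSite bb κ % ((P m : ℕ) : ℤ) = ((P m : ℕ) : ℤ) - 1 ∧ u' κ' % ((P m : ℕ) : ℤ) = ((P m : ℕ) : ℤ) - 1 ∧ x κ₁ % ((P m : ℕ) : ℤ) = ((P m : ℕ) : ℤ) - 1 ∧ z κ₂ % ((P m : ℕ) : ℤ) = ((P m : ℕ) : ℤ) - 1 then
            ((fun κ u κ' u' => (cE₂ * (Lc : ℝ) ^ (2 * (3 + 1))) • mmRead Lc (K3OfK (unitK (sfStep Lc i) (smStep 3 Lc i) (coDressKBmAt (toSite r) Lc (KInvStep (d := 3) Lc i))) Lc (unitS (sfStep Lc i) (smStep 3 Lc i) (SpureRecAt 3 Lc (toSite r) cE cVH cΛ i)) (unitM (sfStep Lc i) (smStep 3 Lc i) (M1At 3 Lc (toSite r) cΛ i)) (W2SymOfK (unitK (sfStep Lc i) (smStep 3 Lc i) (coDressKBmAt (toSite r) Lc (KInvStep (d := 3) Lc i))) Lc (unitS (sfStep Lc i) (smStep 3 Lc i) (SpureRecAt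 3 Lc (toSite r) cE cVH cΛ i)) (unitM (sfStep Lc i) (smStep 3 Lc i) (M1At 3 Lc (toSite r) cΛ i)) 0 (unitM₂ (sfStep Lc i) (smStep 3 Lc i) (M2Of 3 Lc (mixFFAt (toSite r) Lc) i))) κ u κ' u') + cB • vh₂S κ u κ' u')) κ (toSite bb) κ' u' x z (Sum.inl κ₁) (Sum.inl κ₂) else 0))
        + (∑ bb ∈ box (3 + 1) (P m), ∑' u' : Site (3 + 1), ∑' x : Site (3 + 1), ∑' z : Site (3 + 1),
          (if toSite bb κ' % ((P m : ℕ) : ℤ) = ((P m : ℕ) : ℤ) - 1 ∧ u' κ % ((P m : ℕ) : ℤ) = ((P m : ℕ) : ℤ) - 1 ∧ x κ₁ % ((P m : ℕ) : ℤ) = ((P m : ℕ) : ℤ) - 1 ∧ z κ₂ % ((P m : ℕ) : ℤ) = ((P m : ℕ) : ℤ) - 1 then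
            ((fun κ u κ' u' => (cE₂ * (Lc : ℝ) ^ (2 * (3 + 1))) • mmRead Lc (K3OfK (unitK (sfStep Lc i) (smStep 3 Lc i) (coDressKBmAt (toSite r) Lc (KInvStep (d := 3) Lc i))) Lc (unitS (sfStep Lc i) (smStep 3 Lc i) (SpureRecAt 3 Lc (toSite r) cE cVH cΛ i)) (unitM (sfStep Lc i) (smStep 3 Lc i) (M1At 3 Lc (toSite r) cΛ i)) (W2SymOfK (unitK (sfStep Lc i) (smStep 3 Lc i) (coDressKBmAt (toSite r) Lc (KInvStep (d := 3) Lc i))) Lc (unitS (sfStep Lc i) (smStep 3 Lc i) (SpureRecAt 3 Lc (toSite r) cE cVH cΛ i)) (unitM (sfStep Lc i) (smStep 3 Lc i) (M1At 3 Lc (toSite r) cΛ i)) 0 (unitM₂ (sfStep Lc i) (smStep 3 Lc i) (M2Of 3 Lc (mixFFAt (toSite r) Lc) i))) κ u κ' u') + cB • vh₂S κ u κ' u')) κ' (toSite bb) κ u' x z (Sum.inl κ₁) (Sum.inl κ₂) else 0)))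
      + ((∑ bb ∈ box (3 + 1) (P m), ∑' u' : Site (3 + 1), ∑' x : Site (3 + 1), ∑' z : Site (3 + 1),
          (if toSite bb κ' % ((P m : ℕ) : ℤ) = ((P m : ℕ) : ℤ) - 1 ∧ u' κ % ((P m : ℕ) : ℤ) = ((P m : ℕ) : ℤ) - 1 ∧ x κ₁ % ((P m : ℕ) : ℤ) = ((P m : ℕ) : ℤ) - 1 ∧ z κ₂ % ((P m : ℕ) : ℤ) = ((P m : ℕ) : ℤ) - 1 then
            ((fun κ u κ' u' => (cE₂ * (Lc : ℝ) ^ (2 * (3 + 1))) • mmRead Lc (K3OfK (unitK (sfStep Lc i) (smStep 3 Lc i) (coDressKBmAt (toSite r) Lc (KInvStep (d := 3) Lc i))) Lc (unitS (sfStep Lc i) (smStep 3 Lc i) (SpureRecAt 3 Lc (toSite r) cE cVH cΛ i)) (unitM (sfStep Lc i) (smStep 3 Lc i) (M1At 3 Lc (toSite r) cΛ i)) (W2SymOfK (unitK (sfStep Lc i) (smStep 3 Lc i) (coDressKBmAt (toSite r) Lc (KInvStep (d := 3) Lc i))) Lc (unitS (sfStep Lc i) (smStep 3 Lc i) (SpureRecAt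 3 Lc (toSite r) cE cVH cΛ i)) (unitM (sfStep Lc i) (smStep 3 Lc i) (M1At 3 Lc (toSite r) cΛ i)) 0 (unitM₂ (sfStep Lc i) (smStep 3 Lc i) (M2Of 3 Lc (mixFFAt (toSite r) Lc) i))) κ u κ' u') + cB • vh₂S κ u κ' u')) κ' (toSite bb) κ u' x z (Sum.inl κ₁) (Sum.inl κ₂) else 0))
        + (∑ bb ∈ box (3 + 1) (P m), ∑' u' : Site (3 + 1), ∑' x : Site (3 + 1), ∑' z : Site (3 + 1),
          (if toSite bb κ % ((P m : ℕ) : ℤ) = ((P m : ℕ) : ℤ) - 1 ∧ u' κ' % ((P m : ℕ) : ℤ) = ((P m : ℕ) : ℤ) - 1 ∧ x κ₁ % ((P m : ℕ) : ℤ) = ((P m : ℕ) : ℤ) - 1 ∧ z κ₂ % ((P m : ℕ) : ℤ) = ((P m : ℕ) : ℤ) - 1 then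
            ((fun κ u κ' u' => (cE₂ * (Lc : ℝ) ^ (2 * (3 + 1))) • mmRead Lc (K3OfK (unitK (sfStep Lc i) (smStep 3 Lc i) (coDressKBmAt (toSite r) Lc (KInvStep (d := 3) Lc i))) Lc (unitS (sfStep Lc i) (smStep 3 Lc i) (SpureRecAt 3 Lc (toSite r) cE cVH cΛ i)) (unitM (sfStep Lc i) (smStep 3 Lc i) (M1At 3 Lc (toSite r) cΛ i)) (W2SymOfK (unitK (sfStep Lc i) (smStep 3 Lc i) (coDressKBmAt (toSite r) Lc (KInvStep (d := 3) Lc i))) Lc (unitS (sfStep Lc i) (smStep 3 Lc i) (SpureRecAt 3 Lc (toSite r) cE cVH cΛ i)) (unitM (sfStep Lc i) (smStep 3 Lc i) (M1At 3 Lc (toSite r) cΛ i)) 0 (unitM₂ (sfStep Lc i) (smStep 3 Lc i) (M2Of 3 Lc (mixFFAt (toSite r) Lc) i))) κ u κ' u') + cB • vh₂S κ u κ' u')) κ (toSite bb) κ' u' x z (Sum.inl κ₁) (Sum.inl κ₂) else 0)))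
      + (((∑ bb ∈ box (3 + 1) (P m), ∑' u' : Site (3 + 1), ∑' x : Site (3 + 1), ∑' z : Site (3 + 1),
          (if toSite bb κ % ((P m : ℕ) : ℤ) = ((P m : ℕ) : ℤ) - 1 ∧ u' κ' % ((P m : ℕ) : ℤ) = ((P m : ℕ) : ℤ) - 1 ∧ x κ₂ % ((P m : ℕ) : ℤ) = ((P m : ℕ) : ℤ) - 1 ∧ z κ₁ % ((P m : ℕ) : ℤ) = ((P m : ℕ) : ℤ) - 1 then
            ((fun κ u κ' u' => (cE₂ * (Lc : ℝ) ^ (2 * (3 + 1))) • mmRead Lc (K3OfK (unitK (sfStep Lc i) (smStep 3 Lc i) (coDressKBmAt (toSite r) Lc (KInvStep (d := 3) Lc i))) Lc (unitS (sfStep Lc i) (smStep 3 Lc i) (SpureRecAt 3 Lc (toSite r) cE cVH cΛ i)) (unitM (sfStep Lc i) (smStep 3 Lc i) (M1At 3 Lc (toSite r) cΛ i)) (W2SymOfK (unitK (sfStep Lc i) (smStep 3 Lc i) (coDressKBmAt (toSite r) Lc (KInvStep (d := 3) Lc i))) Lc (unitS (sfStep Lc i) (smStep 3 Lc i) (SpureRecAt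 3 Lc (toSite r) cE cVH cΛ i)) (unitM (sfStep Lc i) (smStep 3 Lc i) (M1At 3 Lc (toSite r) cΛ i)) 0 (unitM₂ (sfStep Lc i) (smStep 3 Lc i) (M2Of 3 Lc (mixFFAt (toSite r) Lc) i))) κ u κ' u') + cB • vh₂S κ u κ' u')) κ (toSite bb) κ' u' x z (Sum.inl κ₂) (Sum.inl κ₁) else 0))
        + (∑ bb ∈ box (3 + 1) (P m), ∑' u' : Site (3 + 1), ∑' x : Site (3 + 1), ∑' z : Site (3 + 1),
          (if toSite bb κ' % ((P m : ℕ) : ℤ) = ((P m : ℕ) : ℤ) - 1 ∧ u' κ % ((P m : ℕ) : ℤ) = ((P m : ℕ) : ℤ) - 1 ∧ x κ₂ % ((P m : ℕ) : ℤ) = ((P m : ℕ) : ℤ) - 1 ∧ z κ₁ % ((P m : ℕ) : ℤ) = ((P m : ℕ) : ℤ) - 1 then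
            ((fun κ u κ' u' => (cE₂ * (Lc : ℝ) ^ (2 * (3 + 1))) • mmRead Lc (K3OfK (unitK (sfStep Lc i) (smStep 3 Lc i) (coDressKBmAt (toSite r) Lc (KInvStep (d := 3) Lc i))) Lc (unitS (sfStep Lc i) (smStep 3 Lc i) (SpureRecAt 3 Lc (toSite r) cE cVH cΛ i)) (unitM (sfStep Lc i) (smStep 3 Lc i) (M1At 3 Lc (toSite r) cΛ i)) (W2SymOfK (unitK (sfStep Lc i) (smStep 3 Lc i) (coDressKBmAt (toSite r) Lc (KInvStep (d := 3) Lc i))) Lc (unitS (sfStep Lc i) (smStep 3 Lc i) (SpureRecAt 3 Lc (toSite r) cE cVH cΛ i)) (unitM (sfStep Lc i) (smStep 3 Lc i) (M1At 3 Lc (toSite r) cΛ i)) 0 (unitM₂ (sfStep Lc i) (smStep 3 Lc i) (M2Of 3 Lc (mixFFAt (toSite r) Lc) i))) κ u κ' u') + cB • vh₂S κ u κ' u')) κ' (toSite bb) κ u' x z (Sum.inl κ₂) (Sum.inl κ₁) else 0)))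
      + ((∑ bb ∈ box (3 + 1) (P m), ∑' u' : Site (3 + 1), ∑' x : Site (3 + 1), ∑' z : Site (3 + 1),
          (if toSite bb κ' % ((P m : ℕ) : ℤ) = ((P m : ℕ) : ℤ) - 1 ∧ u' κ % ((P m : ℕ) : ℤ) = ((P m : ℕ) : ℤ) - 1 ∧ x κ₂ % ((P m : ℕ) : ℤ) = ((P m : ℕ) : ℤ) - 1 ∧ z κ₁ % ((P m : ℕ) : ℤ) = ((P m : ℕ) : ℤ) - 1 then
            ((fun κ u κ' u' => (cE₂ * (Lc : ℝ) ^ (2 * (3 + 1))) • mmRead Lc (K3OfK (unitK (sfStep Lc i) (smStep 3 Lc i) (coDressKBmAt (toSite r) Lc (KInvStep (d := 3) Lc i))) Lc (unitS (sfStep Lc i) (smStep 3 Lc i) (SpureRecAt 3 Lc (toSite r) cE cVH cΛ i)) (unitM (sfStep Lc i) (smStep 3 Lc i) (M1At 3 Lc (toSite r) cΛ i)) (W2SymOfK (unitK (sfStep Lc i) (smStep 3 Lc i) (coDressKBmAt (toSite r) Lc (KInvStep (d := 3) Lc i))) Lc (unitS (sfStep Lc i) (smStep 3 Lc i) (SpureRecAt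 3 Lc (toSite r) cE cVH cΛ i)) (unitM (sfStep Lc i) (smStep 3 Lc i) (M1At 3 Lc (toSite r) cΛ i)) 0 (unitM₂ (sfStep Lc i) (smStep 3 Lc i) (M2Of 3 Lc (mixFFAt (toSite r) Lc) i))) κ u κ' u') + cB • vh₂S κ u κ' u')) κ' (toSite bb) κ u' x z (Sum.inl κ₂) (Sum.inl κ₁) else 0))
        + (∑ bb ∈ box (3 + 1) (P m), ∑' u' : Site (3 + 1), ∑' x : Site (3 + 1), ∑' z : Site (3 + 1),
          (if toSite bb κ % ((P m : ℕ) : ℤ) = ((P m : ℕ) : ℤ) - 1 ∧ u' κ' % ((P m : ℕ) : ℤ) = ((P m : ℕ) : ℤ) - 1 ∧ x κ₂ % ((P m : ℕ) : ℤ) = ((P m : ℕ) : ℤ) - 1 ∧ z κ₁ % ((P m : ℕ) : ℤ) = ((P m : ℕ) : ℤ) - 1 then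
            ((fun κ u κ' u' => (cE₂ * (Lc : ℝ) ^ (2 * (3 + 1))) • mmRead Lc (K3OfK (unitK (sfStep Lc i) (smStep 3 Lc i) (coDressKBmAt (toSite r) Lc (KInvStep (d := 3) Lc i))) Lc (unitS (sfStep Lc i) (smStep 3 Lc i) (SpureRecAt 3 Lc (toSite r) cE cVH cΛ i)) (unitM (sfStep Lc i) (smStep 3 Lc i) (M1At 3 Lc (toSite r) cΛ i)) (W2SymOfK (unitK (sfStep Lc i) (smStep 3 Lc i) (coDressKBmAt (toSite r) Lc (KInvStep (d := 3) Lc i))) Lc (unitS (sfStep Lc i) (smStep 3 Lc i) (SpureRecAt 3 Lc (toSite r) cE cVH cΛ i)) (unitM (sfStep Lc i) (smStep 3 Lc i) (M1At 3 Lc (toSite r) cΛ i)) 0 (unitM₂ (sfStep Lc i) (smStep 3 Lc i) (M2Of 3 Lc (mixFFAt (toSite r) Lc) i))) κ u κ' u') + cB • vh₂S κ u κ' u')) κ (toSite bb) κ' u' x z (Sum.inl κ₂) (Sum.inl κ₁) else 0)))))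
          = T κ κ₁ κ' κ₂ + T κ' κ₁ κ κ₂ + (T κ κ₂ κ' κ₁ + T κ' κ₂ κ κ₁) := by
  have hPpos : ∀ m, 1 ≤ P m := by
    intro m
    induction m with
    | zero => rw [hP0]; exact hLc
    | succ m ih => rw [hPs]; exact Nat.mul_pos hLc ih
  intro m i
  exact forcingFacePairForm_root (d := 3) hLc hr cE cVH cΛ (cE₂ * (Lc : ℝ) ^ (2 * (3 + 1))) cB hBff (hPpos m) i

end Summit.QuantumFields.BalabanUV.Beta.GAN24.CombChargeTowerForcingAdapter

end
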